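import Summits.Parity.GeneralizedHardyLittlewood.Theorems.ChenParityOracleBLAPHostParityFromBrickVaughanSplit
import Literature.NumberTheory.LFunctions.LiouvilleSumClassicalBound
import HarnessLib

/-!
# Route `ChenParityOracleBLAP` — crux S1 = `HostParityFromBrick` (stmt-Parity-20045): Vaughan's Type-I pieces against the sifted Type-I bound

Support file for the prime half `K1 → K2 → HP1` of S1 (step (V)).  With the weight
`h_d(k) = 1_{(k,P)=1} [d ∣ k+2] λ(k+2)` (`P = (N−1)#`), the Type-I pieces of Vaughan's identity
are reduced to the sifted Type-I bound, taken here as a hypothesis `HTI` of exactly the shape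
proved in `…SiftedTypeI` (`∀ u ≤ x`, all `|c_b| ≤ 1` supported on rough `b`, level sum `≤ X₁`):
* `sum_abs_T2a_le` — `∑_d |∑_{b ≤ B} c_U(b) ∑_{t ≤ y/b} h_d(bt)| ≤ (log x) X₁` (`|c_U(b)| ≤ log b`);
* `sum_abs_typeI_log_le` — `∑_d |∑_{b ≤ B} c_b ∑_{t ≤ y/b} (log (bt)) h_d(bt)| ≤ (log y) X₁·2`-type
  bound by Abel summation in the height (weights `log j − log(j−1) ≥ 0`);
* `sum_abs_T1_le` — `∑_d |∑_{b ≤ B} μ(b) ∑_{t ≤ y/b} (log t) h_d(bt)| ≤ 3 (log x) X₁`.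

References: R. C. Vaughan, Acta Arith. 37 (1980) [Vaughan1980]; H. Iwaniec, E. Kowalski,
*Analytic Number Theory* (2004), §13.4 [IwaniecKowalski2004].
-/

namespace Summit.Parity.GeneralizedHardyLittlewood.Theorems

open Finset Real
open ArithmeticFunction
open scoped ArithmeticFunction.Moebius
open Literature.NumberTheory.Sieve.Vaughan (cU abs_cU_le_log log_eq_sum_Ioc_sub log_sub_log_pred_nonneg)

/-- The inner sum against the rough weight: for any `b`,
`∑_{t ≤ T} g(t) h_d(bt) = [(b,P)=1] ∑_{t ≤ T, (t,P)=1} g(t) [d ∣ bt+2] λ(bt+2)`. -/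
theorem inner_rough_weight_eq (P d b T : ℕ) (g : ℕ → ℝ) :
    ∑ t ∈ Ioc 0 T, g t * ((if Nat.Coprime (b * t) P then (1 : ℝ) else 0) *
        (if d ∣ b * t + 2 then (liouville (b * t + 2) : ℝ) else 0)) =
      (if Nat.Coprime b P then (1 : ℝ) else 0) *
        ∑ t ∈ (Icc 1 T).filter (fun t => Nat.Coprime t P),
          g t * (if d ∣ b * t + 2 then (liouville (b * t + 2) : ℝ) else 0) := by
  have hIcc : Icc 1 T = Ioc 0 T := by ext t; simp only [Finset.mem_Icc, Finset.mem_Ioc]; omega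
  rw [hIcc, Finset.sum_filter, Finset.mul_sum]
  refine Finset.sum_congr rfl fun t _ => ?_
  by_cases hbt : Nat.Coprime (b * t) P
  · rw [if_pos hbt, if_pos (Nat.Coprime.coprime_mul_right hbt),
      if_pos (Nat.Coprime.coprime_mul_left hbt)]
    ring
  · rw [if_neg hbt]
    by_cases hb : Nat.Coprime b P
    · have ht : ¬ Nat.Coprime t P := fun ht => hbt (Nat.Coprime.mul_left hb ht)
      rw [if_pos hb, if_neg ht]; ring
    · rw [if_neg hb]; ring

/-- The inner sum against the rough weight, without an extra factor. -/
theorem inner_rough_weight_eq_one (P d b T : ℕ) :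
    ∑ t ∈ Ioc 0 T, ((if Nat.Coprime (b * t) P then (1 : ℝ) else 0) *
        (if d ∣ b * t + 2 then (liouville (b * t + 2) : ℝ) else 0)) =
      (if Nat.Coprime b P then (1 : ℝ) else 0) *
        ∑ t ∈ (Icc 1 T).filter (fun t => Nat.Coprime t P),
          (if d ∣ b * t + 2 then (liouville (b * t + 2) : ℝ) else 0) := by
  have h := inner_rough_weight_eq P d b T (fun _ => (1 : ℝ))
  simpa only [one_mul] using h

/-- **Generic Type-I piece.**  For coefficients `a` with `|a b| ≤ L` on `[1, B]` and the sifted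
Type-I bound `HTI` (constant `X₁`), with `0 < L`:
`∑_{d ∈ Dset} |∑_{b ≤ B} a(b) ∑_{t ≤ u/b} h_d(bt)| ≤ L X₁` for every `u ≤ x`. -/
theorem sum_abs_typeI_piece_le {x u B P : ℕ} (hux : u ≤ x) (Dset : Finset ℕ) {X₁ L : ℝ} (hL : 0 < L)
    (HTI : ∀ u : ℕ, u ≤ x → ∀ cb : ℕ → ℝ, (∀ b, |cb b| ≤ 1) →
      (∀ b, cb b ≠ 0 → Nat.Coprime b P) →
      ∑ d ∈ Dset, |∑ b ∈ Icc 1 B, cb b *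
        ∑ t ∈ (Icc 1 (u / b)).filter (fun t => Nat.Coprime t P),
          (if d ∣ b * t + 2 then (liouville (b * t + 2) : ℝ) else 0)| ≤ X₁)
    (a : ℕ → ℝ) (ha : ∀ b ∈ Icc 1 B, |a b| ≤ L) :
    ∑ d ∈ Dset, |∑ b ∈ Icc 1 B, a b * ∑ t ∈ Ioc 0 (u / b),
        ((if Nat.Coprime (b * t) P then (1 : ℝ) else 0) *
          (if d ∣ b * t + 2 then (liouville (b * t + 2) : ℝ) else 0))| ≤ L * X₁ := by
  classical
  set cb : ℕ → ℝ := fun b =>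
    if b ∈ Icc 1 B ∧ Nat.Coprime b P then a b / L else 0 with hcb
  have hcb1 : ∀ b, |cb b| ≤ 1 := by
    intro b; simp only [hcb]
    split_ifs with h
    · rw [abs_div, abs_of_pos hL, div_le_one hL]; exact ha b h.1
    · simp
  have hcbP : ∀ b, cb b ≠ 0 → Nat.Coprime b P := by
    intro b hb; simp only [hcb] at hb
    split_ifs at hb with h
    · exact h.2
    · exact absurd rfl hb
  have h := HTI u hux cb hcb1 hcbP
  -- identify: our sum = `L ·` the `cb`-sum
  have hid : ∀ d : ℕ, ∑ b ∈ Icc 1 B, a b * ∑ t ∈ Ioc 0 (u / b),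
        ((if Nat.Coprime (b * t) P then (1 : ℝ) else 0) *
          (if d ∣ b * t + 2 then (liouville (b * t + 2) : ℝ) else 0)) =
      L * ∑ b ∈ Icc 1 B, cb b *
        ∑ t ∈ (Icc 1 (u / b)).filter (fun t => Nat.Coprime t P),
          (if d ∣ b * t + 2 then (liouville (b * t + 2) : ℝ) else 0) := by
    intro d
    rw [Finset.mul_sum]
    refine Finset.sum_congr rfl fun b hb => ?_
    rw [inner_rough_weight_eq_one P d b (u / b)]
    simp only [hcb, hb, true_and]
    split_ifs with hbP
    · field_simp
    · simp
  simp only [hid, abs_mul, abs_of_pos hL, ← Finset.mul_sum]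
  exact mul_le_mul_of_nonneg_left h hL.le

/-- **The Type-I piece `T₂ₐ`** (`c_U`, outer variable `b ≤ B ≤ x`): `≤ (log x) X₁` (for `x ≥ 2`). -/
theorem sum_abs_T2a_le {x y B U P : ℕ} (hx : 2 ≤ x) (hyx : y ≤ x) (hBx : B ≤ x) (Dset : Finset ℕ)
    {X₁ : ℝ}
    (HTI : ∀ u : ℕ, u ≤ x → ∀ cb : ℕ → ℝ, (∀ b, |cb b| ≤ 1) →
      (∀ b, cb b ≠ 0 → Nat.Coprime b P) →
      ∑ d ∈ Dset, |∑ b ∈ Icc 1 B, cb b *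
        ∑ t ∈ (Icc 1 (u / b)).filter (fun t => Nat.Coprime t P),
          (if d ∣ b * t + 2 then (liouville (b * t + 2) : ℝ) else 0)| ≤ X₁) :
    ∑ d ∈ Dset, |∑ b ∈ Icc 1 B, cU U b * ∑ t ∈ Ioc 0 (y / b),
        ((if Nat.Coprime (b * t) P then (1 : ℝ) else 0) *
          (if d ∣ b * t + 2 then (liouville (b * t + 2) : ℝ) else 0))| ≤
      Real.log x * X₁ := by
  have hlog : 0 < Real.log x := Real.log_pos (by exact_mod_cast hx)
  refine sum_abs_typeI_piece_le hyx Dset hlog HTI (cU U) fun b hb => ?_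
  rw [Finset.mem_Icc] at hb
  exact (abs_cU_le_log U b).trans (Real.log_le_log (by exact_mod_cast hb.1)
    (by exact_mod_cast hb.2.trans hBx))

/-- **Abel summation in the height (identity).**  With `w_j = log j − log(j−1)` and
`A(u) = ∑_{b ≤ B} ∑_{t ≤ u/b} G(b,t)`:
`∑_{b ≤ B} ∑_{t ≤ y/b} log(bt) G(b,t) = ∑_{j ≤ y} w_j (A(y) − A(j−1))`. -/
theorem sum_log_mul_eq_abel (B y : ℕ) (G : ℕ → ℕ → ℝ) :
    ∑ b ∈ Icc 1 B, ∑ t ∈ Ioc 0 (y / b), Real.log ((b * t : ℕ) : ℝ) * G b t =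
      ∑ j ∈ Ioc 0 y, (Real.log j - Real.log (j - 1 : ℕ)) *
        (∑ b ∈ Icc 1 B, ∑ t ∈ Ioc 0 (y / b), G b t -
          ∑ b ∈ Icc 1 B, ∑ t ∈ Ioc 0 ((j - 1) / b), G b t) := by
  classical
  set w : ℕ → ℝ := fun j => Real.log j - Real.log (j - 1 : ℕ) with hw
  -- `log k = ∑_{j ≤ y} [j ≤ k] w_j` for `k ≤ y`
  have hlog : ∀ k, k ≤ y → Real.log (k : ℝ) = ∑ j ∈ Ioc 0 y, if j ≤ k then w j else 0 := by
    intro k hk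
    rw [log_eq_sum_Ioc_sub k, ← Finset.sum_filter]
    refine Finset.sum_congr ?_ fun j _ => rfl
    ext j; simp only [Finset.mem_Ioc, Finset.mem_filter]; omega
  -- per `b`
  have hb : ∀ b ∈ Icc 1 B, ∑ t ∈ Ioc 0 (y / b), Real.log ((b * t : ℕ) : ℝ) * G b t =
      ∑ j ∈ Ioc 0 y, w j * (∑ t ∈ Ioc 0 (y / b), G b t - ∑ t ∈ Ioc 0 ((j - 1) / b), G b t) := by
    intro b hb
    rw [Finset.mem_Icc] at hb
    have hb0 : 0 < b := hb.1
    have h1 : ∑ t ∈ Ioc 0 (y / b), Real.log ((b * t : ℕ) : ℝ) * G b t =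
        ∑ t ∈ Ioc 0 (y / b), ∑ j ∈ Ioc 0 y, (if j ≤ b * t then w j else 0) * G b t := by
      refine Finset.sum_congr rfl fun t ht => ?_
      rw [Finset.mem_Ioc] at ht
      have hbt : b * t ≤ y := by
        have := (Nat.le_div_iff_mul_le hb0).1 ht.2; rw [mul_comm]; exact this
      rw [hlog (b * t) hbt, Finset.sum_mul]
    rw [h1, Finset.sum_comm]
    refine Finset.sum_congr rfl fun j hj => ?_
    rw [Finset.mem_Ioc] at hj
    -- `∑_{t ≤ y/b} [j ≤ bt] w_j G = w_j (∑_{t ≤ y/b} G − ∑_{t ≤ (j-1)/b} G)`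
    have hsub : Ioc 0 ((j - 1) / b) ⊆ Ioc 0 (y / b) :=
      Finset.Ioc_subset_Ioc_right (Nat.div_le_div_right (by omega))
    have hset : Ioc 0 (y / b) \ Ioc 0 ((j - 1) / b) =
        (Ioc 0 (y / b)).filter (fun t => j ≤ b * t) := by
      ext t
      simp only [Finset.mem_sdiff, Finset.mem_Ioc, Finset.mem_filter, not_and, not_le]
      constructor
      · rintro ⟨⟨ht0, hty⟩, h⟩
        refine ⟨⟨ht0, hty⟩, ?_⟩
        have h' : (j - 1) / b < t := h ht0
        by_contra hlt
        push Not at hlt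
        have : b * t ≤ j - 1 := by omega
        have : t ≤ (j - 1) / b := (Nat.le_div_iff_mul_le hb0).2 (by rw [mul_comm]; exact this)
        omega
      · rintro ⟨⟨ht0, hty⟩, hj'⟩
        refine ⟨⟨ht0, hty⟩, fun _ => ?_⟩
        by_contra hle
        push Not at hle
        have : t * b ≤ j - 1 := (Nat.le_div_iff_mul_le hb0).1 hle
        rw [mul_comm] at this
        omega
    rw [← Finset.sum_sdiff_eq_sub hsub, hset, Finset.sum_filter, Finset.mul_sum]
    refine Finset.sum_congr rfl fun t _ => ?_
    split_ifs <;> simp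
  rw [Finset.sum_congr rfl hb, Finset.sum_comm]
  refine Finset.sum_congr rfl fun j _ => ?_
  rw [← Finset.mul_sum, Finset.sum_sub_distrib]

/-- **Abel summation in the height (bound).**  For coefficients `|a b| ≤ L` (`L > 0`) and `y ≤ x`:
`∑_{d} |∑_{b ≤ B} a(b) ∑_{t ≤ y/b} log(bt) h_d(bt)| ≤ 2 (log y) L X₁`. -/
theorem sum_abs_typeI_logk_le {x y B P : ℕ} (hyx : y ≤ x) (Dset : Finset ℕ) {X₁ L : ℝ} (hL : 0 < L)
    (HTI : ∀ u : ℕ, u ≤ x → ∀ cb : ℕ → ℝ, (∀ b, |cb b| ≤ 1) →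
      (∀ b, cb b ≠ 0 → Nat.Coprime b P) →
      ∑ d ∈ Dset, |∑ b ∈ Icc 1 B, cb b *
        ∑ t ∈ (Icc 1 (u / b)).filter (fun t => Nat.Coprime t P),
          (if d ∣ b * t + 2 then (liouville (b * t + 2) : ℝ) else 0)| ≤ X₁)
    (a : ℕ → ℝ) (ha : ∀ b ∈ Icc 1 B, |a b| ≤ L) :
    ∑ d ∈ Dset, |∑ b ∈ Icc 1 B, a b * ∑ t ∈ Ioc 0 (y / b), Real.log ((b * t : ℕ) : ℝ) *
        ((if Nat.Coprime (b * t) P then (1 : ℝ) else 0) *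
          (if d ∣ b * t + 2 then (liouville (b * t + 2) : ℝ) else 0))| ≤
      2 * Real.log y * (L * X₁) := by
  classical
  set H : ℕ → ℕ → ℕ → ℝ := fun d b t => (if Nat.Coprime (b * t) P then (1 : ℝ) else 0) *
    (if d ∣ b * t + 2 then (liouville (b * t + 2) : ℝ) else 0) with hH
  set A : ℕ → ℕ → ℝ := fun d u => ∑ b ∈ Icc 1 B, a b * ∑ t ∈ Ioc 0 (u / b), H d b t with hA
  set w : ℕ → ℝ := fun j => Real.log j - Real.log (j - 1 : ℕ) with hw
  have hw0 : ∀ j, 0 ≤ w j := fun j => log_sub_log_pred_nonneg j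
  have hX : ∀ u, u ≤ x → ∑ d ∈ Dset, |A d u| ≤ L * X₁ := by
    intro u hu
    have := sum_abs_typeI_piece_le hu Dset hL HTI a ha
    simpa only [hA, hH] using this
  -- the identity for each `d`
  have hid : ∀ d : ℕ, ∑ b ∈ Icc 1 B, a b * ∑ t ∈ Ioc 0 (y / b), Real.log ((b * t : ℕ) : ℝ) *
        ((if Nat.Coprime (b * t) P then (1 : ℝ) else 0) *
          (if d ∣ b * t + 2 then (liouville (b * t + 2) : ℝ) else 0)) =
      ∑ j ∈ Ioc 0 y, w j * (A d y - A d (j - 1)) := by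
    intro d
    have h := sum_log_mul_eq_abel B y (fun b t => a b * H d b t)
    have hL' : ∑ b ∈ Icc 1 B, a b * ∑ t ∈ Ioc 0 (y / b), Real.log ((b * t : ℕ) : ℝ) *
        ((if Nat.Coprime (b * t) P then (1 : ℝ) else 0) *
          (if d ∣ b * t + 2 then (liouville (b * t + 2) : ℝ) else 0)) =
        ∑ b ∈ Icc 1 B, ∑ t ∈ Ioc 0 (y / b), Real.log ((b * t : ℕ) : ℝ) * (a b * H d b t) := by
      refine Finset.sum_congr rfl fun b _ => ?_
      rw [Finset.mul_sum]
      refine Finset.sum_congr rfl fun t _ => ?_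
      simp only [hH]; ring
    rw [hL', h]
    refine Finset.sum_congr rfl fun j _ => ?_
    simp only [hA, hw, Finset.mul_sum]
  -- bound
  have hylog : ∑ j ∈ Ioc 0 y, w j = Real.log y := by rw [hw, ← log_eq_sum_Ioc_sub y]
  calc ∑ d ∈ Dset, |∑ b ∈ Icc 1 B, a b * ∑ t ∈ Ioc 0 (y / b), Real.log ((b * t : ℕ) : ℝ) *
          ((if Nat.Coprime (b * t) P then (1 : ℝ) else 0) *
            (if d ∣ b * t + 2 then (liouville (b * t + 2) : ℝ) else 0))|
      = ∑ d ∈ Dset, |∑ j ∈ Ioc 0 y, w j * (A d y - A d (j - 1))| := by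
        refine Finset.sum_congr rfl fun d _ => ?_; rw [hid d]
    _ ≤ ∑ d ∈ Dset, ∑ j ∈ Ioc 0 y, w j * (|A d y| + |A d (j - 1)|) := by
        refine Finset.sum_le_sum fun d _ => (Finset.abs_sum_le_sum_abs _ _).trans
          (Finset.sum_le_sum fun j _ => ?_)
        rw [abs_mul, abs_of_nonneg (hw0 j)]
        exact mul_le_mul_of_nonneg_left (abs_sub _ _) (hw0 j)
    _ = ∑ j ∈ Ioc 0 y, w j * (∑ d ∈ Dset, |A d y| + ∑ d ∈ Dset, |A d (j - 1)|) := by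
        rw [Finset.sum_comm]
        refine Finset.sum_congr rfl fun j _ => ?_
        rw [← Finset.mul_sum, Finset.sum_add_distrib]
    _ ≤ ∑ j ∈ Ioc 0 y, w j * (L * X₁ + L * X₁) := by
        refine Finset.sum_le_sum fun j hj => mul_le_mul_of_nonneg_left ?_ (hw0 j)
        rw [Finset.mem_Ioc] at hj
        exact add_le_add (hX y hyx) (hX (j - 1) (by omega))
    _ = 2 * Real.log y * (L * X₁) := by rw [← Finset.sum_mul, hylog]; ring

/-- **The Type-I piece `T₁`** (`μ_{≤B} * log`): for `2 ≤ x`, `y ≤ x`, `B ≤ x`: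
`∑_d |∑_{b ≤ B} μ(b) ∑_{t ≤ y/b} (log t) h_d(bt)| ≤ 3 (log x) X₁`. -/
theorem sum_abs_T1_le {x y B P : ℕ} (hx : 2 ≤ x) (hyx : y ≤ x) (hBx : B ≤ x) (Dset : Finset ℕ)
    {X₁ : ℝ}
    (HTI : ∀ u : ℕ, u ≤ x → ∀ cb : ℕ → ℝ, (∀ b, |cb b| ≤ 1) →
      (∀ b, cb b ≠ 0 → Nat.Coprime b P) →
      ∑ d ∈ Dset, |∑ b ∈ Icc 1 B, cb b *
        ∑ t ∈ (Icc 1 (u / b)).filter (fun t => Nat.Coprime t P),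
          (if d ∣ b * t + 2 then (liouville (b * t + 2) : ℝ) else 0)| ≤ X₁) :
    ∑ d ∈ Dset, |∑ b ∈ Icc 1 B, (μ b : ℝ) * ∑ t ∈ Ioc 0 (y / b), Real.log t *
        ((if Nat.Coprime (b * t) P then (1 : ℝ) else 0) *
          (if d ∣ b * t + 2 then (liouville (b * t + 2) : ℝ) else 0))| ≤
      3 * Real.log x * X₁ := by
  classical
  have hlog : 0 < Real.log x := Real.log_pos (by exact_mod_cast hx)
  have hX0 : 0 ≤ X₁ := by
    have := HTI 0 (Nat.zero_le _) (fun _ => 0) (fun _ => by simp) (fun _ h => absurd rfl h)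
    exact le_trans (Finset.sum_nonneg fun _ _ => abs_nonneg _) this
  set H : ℕ → ℕ → ℕ → ℝ := fun d b t => (if Nat.Coprime (b * t) P then (1 : ℝ) else 0) *
    (if d ∣ b * t + 2 then (liouville (b * t + 2) : ℝ) else 0) with hH
  -- `log t = log(bt) − log b` termwise
  have hsplit : ∀ d : ℕ, ∑ b ∈ Icc 1 B, (μ b : ℝ) * ∑ t ∈ Ioc 0 (y / b), Real.log t * H d b t =
      ∑ b ∈ Icc 1 B, (μ b : ℝ) * ∑ t ∈ Ioc 0 (y / b), Real.log ((b * t : ℕ) : ℝ) * H d b t -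
      ∑ b ∈ Icc 1 B, ((μ b : ℝ) * Real.log b) * ∑ t ∈ Ioc 0 (y / b), H d b t := by
    intro d
    rw [← Finset.sum_sub_distrib]
    refine Finset.sum_congr rfl fun b hb => ?_
    rw [Finset.mem_Icc] at hb
    rw [mul_assoc, Finset.mul_sum (s := Ioc 0 (y / b)) (f := fun t => H d b t), ← mul_sub,
      ← Finset.sum_sub_distrib]
    congr 1
    refine Finset.sum_congr rfl fun t ht => ?_
    rw [Finset.mem_Ioc] at ht
    have hb0 : (0 : ℝ) < b := by exact_mod_cast hb.1
    have ht0 : (0 : ℝ) < t := by exact_mod_cast ht.1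
    push_cast
    rw [Real.log_mul hb0.ne' ht0.ne']
    ring
  -- the two bounds
  have h1 := sum_abs_typeI_logk_le hyx Dset one_pos HTI (fun b => (μ b : ℝ)) (fun b _ => by
    have := ArithmeticFunction.abs_moebius_le_one (n := b); exact_mod_cast this)
  have h2 := sum_abs_typeI_piece_le hyx Dset hlog HTI (fun b => (μ b : ℝ) * Real.log b)
    (fun b hb => by
      rw [Finset.mem_Icc] at hb
      rw [abs_mul]
      have hmu : |(μ b : ℝ)| ≤ 1 := by exact_mod_cast ArithmeticFunction.abs_moebius_le_one
      have hlb : |Real.log b| ≤ Real.log x := by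
        rw [abs_of_nonneg (Real.log_nonneg (by exact_mod_cast hb.1))]
        exact Real.log_le_log (by exact_mod_cast hb.1) (by exact_mod_cast hb.2.trans hBx)
      exact (mul_le_mul hmu hlb (abs_nonneg _) zero_le_one).trans (by rw [one_mul]))
  have hlogy : Real.log y ≤ Real.log x := by
    rcases Nat.eq_zero_or_pos y with rfl | hy
    · simp [hlog.le]
    · exact Real.log_le_log (by exact_mod_cast hy) (by exact_mod_cast hyx)
  simp only [hH] at hsplit h1 h2
  calc ∑ d ∈ Dset, |∑ b ∈ Icc 1 B, (μ b : ℝ) * ∑ t ∈ Ioc 0 (y / b), Real.log t *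
          ((if Nat.Coprime (b * t) P then (1 : ℝ) else 0) *
            (if d ∣ b * t + 2 then (liouville (b * t + 2) : ℝ) else 0))|
      ≤ ∑ d ∈ Dset, (|∑ b ∈ Icc 1 B, (μ b : ℝ) * ∑ t ∈ Ioc 0 (y / b), Real.log ((b * t : ℕ) : ℝ) *
          ((if Nat.Coprime (b * t) P then (1 : ℝ) else 0) *
            (if d ∣ b * t + 2 then (liouville (b * t + 2) : ℝ) else 0))| +
          |∑ b ∈ Icc 1 B, ((μ b : ℝ) * Real.log b) * ∑ t ∈ Ioc 0 (y / b),
          ((if Nat.Coprime (b * t) P then (1 : ℝ) else 0) *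
            (if d ∣ b * t + 2 then (liouville (b * t + 2) : ℝ) else 0))|) := by
        refine Finset.sum_le_sum fun d _ => ?_
        rw [hsplit d]; exact abs_sub _ _
    _ ≤ 2 * Real.log y * (1 * X₁) + Real.log x * X₁ := by
        rw [Finset.sum_add_distrib]; exact add_le_add h1 h2
    _ ≤ 3 * Real.log x * X₁ := by nlinarith

end Summit.Parity.GeneralizedHardyLittlewood.Theorems
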